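import Mathlib
import HarnessLib
import Summits.ValiantsHypothesis.ValiantsHypothesis.Theorems.LacunarySymmetroidMatrixDescartesProductPlusOneRingIsoFacts
import Summits.ValiantsHypothesis.ValiantsHypothesis.Theorems.LacunarySymmetroidMatrixDescartesProductPlusOneCurvatureMargin
import Summits.ValiantsHypothesis.ValiantsHypothesis.Theorems.LacunarySymmetroidMatrixDescartesProductPlusOneDefectShells

/-!
# LINE (A) `product_plus_one` (crux `MatrixDescartes`, 18050, V1) — W-CB, brick C3a part 3: THE FIRST IN-ZONE CELL (RING-ISO against poles)
Pen val-idea-25 g6 memo §30.5 C3 / §31 (e1) made exact: on a pole-free window INSIDE ONE LOBE of a ringed middle/fast knee, all other rows middle/fast POLES,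
`G = L₃S = B − β̃` with `B := Σ_{poles} I_j` LOG-CONVEX (part 1 (P) + ✓ `replicator_curvature_bound`, κ = 0) and `β̃ := −I_{knee} > 0` STRICTLY LOG-CONCAVE
(part 1 (K), Bernstein certificate); three zeros of `G` contradict ✓ `no_three_zeros_of_logCurvature_margin` (E4a); C1 `no_chain_of_sixth_order_law_defects (z := 2)`
gives ★★ `ringIsoPoles_no_nine_zeros` / ★★ `ringIsoPoles_wronskian_roots_le_eight` (`W(∏ f_j)` has ≤ 8 roots there; `m = 1` is the trivial case `G < 0`).
HONEST FRAMING: ONE in-zone W-cell (first kernel instance of C3); scope = one ringed middle/fast knee + middle/fast poles (no slow pole: far-tail log-convexity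
defect for `2p < s < 3p`; no second knee: §31's tilt case), `L₃` regime; nothing here proves `WronskianBudgetK3` / `OneChangeFloorK3` / the stubs / 18050 /
`MatrixDescartes` / B; `VP ≠ VNP` is NOT proved.  No definitions, no named facts, no sorry; Mathlib + ✓ lane modules only.
-/


set_option linter.dupNamespace false

namespace Summit.ValiantsHypothesis.ValiantsHypothesis.Theorems.LacunarySymmetroidMatrixDescartes

namespace ProductPlusOne

open Finset Set Polynomial
open scoped BigOperators Topology Polynomial

/-! ### §5 The in-zone cell -/

/-- ★★ **RING-ISO AGAINST POLES, chain form.**  Binomial company on `d 0 < d 1 < d 2` (`d 1 = d 0 + e₁ + 1`, `d 2 = d 1 + e₂ + 1`,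
`2(e₁+1) ≤ e₂+1`); one row `j₀` is a middle or fast KNEE and the window `(u,v)` (`0 < u`) lies INSIDE its ring (the E3b bracket is `< 0` on the
window); every other row is a middle or fast POLE with `0 ≤ f_j(u)f_j(v)`.  Then `W(∏_j f_j)` has no strictly increasing chain of nine zeros in `(u,v)`.
[this file's theorem] -/
theorem ringIsoPoles_no_nine_zeros {m : ℕ} (d : Fin 3 → ℕ) (e₁ e₂ : ℕ) (he₁ : d 1 = d 0 + e₁ + 1)
    (he₂ : d 2 = d 1 + e₂ + 1) (h2p : 2 * (e₁ + 1) ≤ e₂ + 1) (a : Fin m → Fin 3 → ℝ) {u v : ℝ} (hu : 0 < u) (j₀ : Fin m)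
    (hknee :
      (a j₀ 0 = 0 ∧ 0 < a j₀ 1 * a j₀ 2 ∧ ∀ x ∈ Ioo u v, 6 * ((((e₂ : ℝ) + 1) - ((e₁ : ℝ) + 1)) * (2 * ((e₂ : ℝ) + 1) - ((e₁ : ℝ) + 1)) * (2 * ((e₂ : ℝ) + 1) + ((e₁ : ℝ) + 1)) * (3 * ((e₂ : ℝ) + 1) + ((e₁ : ℝ) + 1)))
            + 240 * ((3 * ((e₂ : ℝ) + 1) + ((e₁ : ℝ) + 1)) * (2 * ((e₂ : ℝ) + 1) - ((e₁ : ℝ) + 1))) * rowPsi1 e₁ e₂ (a j₀ 0) (-(a j₀ 1)) (-(a j₀ 2)) x + 5040 * rowPsi1 e₁ e₂ (a j₀ 0) (-(a j₀ 1)) (-(a j₀ 2)) x ^ 2 < 0) ∨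
      (a j₀ 1 = 0 ∧ 0 < a j₀ 0 * a j₀ 2 ∧ ∀ x ∈ Ioo u v, 6 * (12 * ((e₁ : ℝ) + 1) ^ 4 + 56 * ((e₁ : ℝ) + 1) ^ 3 * ((e₂ : ℝ) + 1) + 89 * ((e₁ : ℝ) + 1) ^ 2 * ((e₂ : ℝ) + 1) ^ 2 + 56 * ((e₁ : ℝ) + 1)
                  * ((e₂ : ℝ) + 1) ^ 3 + 12 * ((e₂ : ℝ) + 1) ^ 4) + 120 * (12 * ((e₁ : ℝ) + 1) ^ 2 + 26 * ((e₁ : ℝ) + 1) * ((e₂ : ℝ) + 1) + 12 * ((e₂ : ℝ) + 1) ^ 2) * rowPsi1 e₁ e₂ (a j₀ 0) (-(a j₀ 1)) (-(a j₀ 2)) x + 5040 * rowPsi1 e₁ e₂ (a j₀ 0) (-(a j₀ 1)) (-(a j₀ 2)) x ^ 2 < 0))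
    (hpoles : ∀ j, j ≠ j₀ → (a j 0 = 0 ∧ a j 1 * a j 2 < 0 ∧ 0 ≤ (∑ l, C (a j l) * X ^ (d l) : ℝ[X]).eval u * (∑ l, C (a j l) * X ^ (d l) : ℝ[X]).eval v) ∨ (a j 1 = 0 ∧ a j 0 * a j 2 < 0 ∧ 0 ≤ (∑ l, C (a j l) * X ^ (d l) : ℝ[X]).eval u * (∑ l, C (a j l) * X ^ (d l) : ℝ[X]).eval v))
    (x : Fin 9 → ℝ) (hx : StrictMono x) (hxI : ∀ i, x i ∈ Ioo u v)
    (hzero : ∀ i, ((∏ j, ∑ l, C (a j l) * X ^ (d l) : ℝ[X]) * (X * derivative (X * derivative (∏ j, ∑ l, C (a j l) * X ^ (d l) : ℝ[X]))) - (X * derivative (∏ j, ∑ l, C (a j l) * X ^ (d l) : ℝ[X])) ^ 2).eval (x i) = 0) : False := by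
  classical
  have hd := fin3_support_eq_gaps d e₁ e₂ he₁ he₂
  have hev : ∀ j x, (∑ l, C (a j l) * X ^ (d l) : ℝ[X]).eval x
      = x ^ (d 0) * (a j 0 + a j 1 * x ^ (e₁ + 1) + a j 2 * x ^ (e₁ + e₂ + 2)) := by
    intro j x
    have h := (eval_trinomial_three (d 0) (e₁ + 1) (e₁ + e₂ + 2) (a j) x).1
    rw [hd] at h; rw [h]; ring
  have huv : u < v := (hxI 0).1.trans (hxI 0).2
  have hv : 0 < v := hu.trans huv
  -- the endpoint product of `f_j` controls the stripped row
  have hstrip : ∀ j, 0 ≤ (∑ l, C (a j l) * X ^ (d l) : ℝ[X]).eval u * (∑ l, C (a j l) * X ^ (d l) : ℝ[X]).eval v → 0 ≤ (a j 0 + a j 1 * u ^ (e₁ + 1) + a j 2 * u ^ (e₁ + e₂ + 2)) * (a j 0 + a j 1 * v ^ (e₁ + 1) + a j 2 * v ^ (e₁ + e₂ + 2)) := by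
    intro j h
    rw [hev, hev] at h
    have hpow : 0 < u ^ (d 0) * v ^ (d 0) := mul_pos (pow_pos hu _) (pow_pos hv _)
    have : u ^ (d 0) * (a j 0 + a j 1 * u ^ (e₁ + 1) + a j 2 * u ^ (e₁ + e₂ + 2)) * (v ^ (d 0) * (a j 0 + a j 1 * v ^ (e₁ + 1) + a j 2 * v ^ (e₁ + e₂ + 2)))
        = (u ^ (d 0) * v ^ (d 0)) * ((a j 0 + a j 1 * u ^ (e₁ + 1) + a j 2 * u ^ (e₁ + e₂ + 2)) * (a j 0 + a j 1 * v ^ (e₁ + 1) + a j 2 * v ^ (e₁ + e₂ + 2))) := by ring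
    rw [this] at h
    exact (mul_nonneg_iff_of_pos_left hpow).1 h
  -- per-row facts: the ringed knee and the poles
  obtain ⟨r₀, L, U, hr₀, hL, hLU, h4U, hc1r, hc0r, hkf⟩ := ringIso_knee_facts e₁ e₂ h2p (a j₀) hu hknee
  have hpf : ∀ j, j ≠ j₀ → ∃ r : ℝ, (r = ((e₁ : ℝ) + 1) ∨ r = ((e₂ : ℝ) + 1) ∨ r = ((e₁ : ℝ) + 1) + ((e₂ : ℝ) + 1)) ∧ 0 ≤ 6 * (21 * r ^ 4 - 5 * (((e₁ : ℝ) + 1) ^ 2 + ((e₂ : ℝ) + 1) ^ 2 + (((e₁ : ℝ) + 1) + ((e₂ : ℝ) + 1)) ^ 2) * r ^ 2 + (((e₁ : ℝ) + 1) ^ 2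
              * ((e₂ : ℝ) + 1) ^ 2 + ((e₁ : ℝ) + 1) ^ 2 * (((e₁ : ℝ) + 1) + ((e₂ : ℝ) + 1)) ^ 2 + ((e₂ : ℝ) + 1) ^ 2 * (((e₁ : ℝ) + 1) + ((e₂ : ℝ) + 1)) ^ 2)) ∧ 0 ≤ 120 * (14 * r ^ 2 - (((e₁ : ℝ) + 1) ^ 2 + ((e₂ : ℝ) + 1) ^ 2 + (((e₁ : ℝ) + 1) + ((e₂ : ℝ) + 1)) ^ 2)) ∧ ∀ x ∈ Ioo u v,
      a j 0 - (-(a j 1)) * x ^ (e₁ + 1) - (-(a j 2)) * x ^ (e₁ + e₂ + 2) ≠ 0 ∧ rowPsi3 e₁ e₂ (a j 0) (-(a j 1)) (-(a j 2)) x = r ^ 2 * rowPsi1 e₁ e₂ (a j 0) (-(a j 1)) (-(a j 2)) x + 6 * rowPsi1 e₁ e₂ (a j 0) (-(a j 1)) (-(a j 2)) x ^ 2 ∧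
      rowPsi2 e₁ e₂ (a j 0) (-(a j 1)) (-(a j 2)) x ^ 2 = r ^ 2 * rowPsi1 e₁ e₂ (a j 0) (-(a j 1)) (-(a j 2)) x ^ 2 + 4 * rowPsi1 e₁ e₂ (a j 0) (-(a j 1)) (-(a j 2)) x ^ 3 ∧ 0 < rowPsi1 e₁ e₂ (a j 0) (-(a j 1)) (-(a j 2)) x := by
    intro j hj
    refine ringIso_pole_facts e₁ e₂ h2p (a j) hu ?_
    rcases hpoles j hj with ⟨h0, hs', hend⟩ | ⟨h1, hs', hend⟩
    · exact Or.inl ⟨h0, hs', hstrip j hend⟩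
    · exact Or.inr ⟨h1, hs', hstrip j hend⟩
  have hall : ∀ j, ∃ r : ℝ, (r = ((e₁ : ℝ) + 1) ∨ r = ((e₂ : ℝ) + 1) ∨ r = ((e₁ : ℝ) + 1) + ((e₂ : ℝ) + 1)) ∧ (∀ x ∈ Ioo u v, a j 0 - (-(a j 1)) * x ^ (e₁ + 1) - (-(a j 2)) * x ^ (e₁ + e₂ + 2) ≠ 0 ∧ rowPsi3 e₁ e₂ (a j 0) (-(a j 1)) (-(a j 2)) x = r ^ 2 * rowPsi1 e₁ e₂ (a j 0) (-(a j 1)) (-(a j 2)) x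
                + 6 * rowPsi1 e₁ e₂ (a j 0) (-(a j 1)) (-(a j 2)) x ^ 2 ∧ rowPsi2 e₁ e₂ (a j 0) (-(a j 1)) (-(a j 2)) x ^ 2 = r ^ 2 * rowPsi1 e₁ e₂ (a j 0) (-(a j 1)) (-(a j 2)) x ^ 2 + 4 * rowPsi1 e₁ e₂ (a j 0) (-(a j 1)) (-(a j 2)) x ^ 3) ∧
      (j ≠ j₀ → 0 ≤ 6 * (21 * r ^ 4 - 5 * (((e₁ : ℝ) + 1) ^ 2 + ((e₂ : ℝ) + 1) ^ 2 + (((e₁ : ℝ) + 1) + ((e₂ : ℝ) + 1)) ^ 2) * r ^ 2 + (((e₁ : ℝ) + 1) ^ 2 * ((e₂ : ℝ) + 1) ^ 2 + ((e₁ : ℝ) + 1) ^ 2 * (((e₁ : ℝ) + 1) + ((e₂ : ℝ) + 1)) ^ 2 + ((e₂ : ℝ) + 1) ^ 2 * (((e₁ : ℝ) + 1) + ((e₂ : ℝ) + 1)) ^ 2)) ∧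
        0 ≤ 120 * (14 * r ^ 2 - (((e₁ : ℝ) + 1) ^ 2 + ((e₂ : ℝ) + 1) ^ 2 + (((e₁ : ℝ) + 1) + ((e₂ : ℝ) + 1)) ^ 2)) ∧ ∀ x ∈ Ioo u v, 0 < rowPsi1 e₁ e₂ (a j 0) (-(a j 1)) (-(a j 2)) x) ∧ (j = j₀ → r = r₀) := by
    intro j
    by_cases hj : j = j₀
    · subst hj
      exact ⟨r₀, hr₀, fun x hx => ⟨(hkf x hx).1, (hkf x hx).2.1, (hkf x hx).2.2.1⟩, fun h => absurd rfl h, fun _ => rfl⟩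
    · obtain ⟨r, hr, hc0', hc1', hf⟩ := hpf j hj
      exact ⟨r, hr, fun x hx => ⟨(hf x hx).1, (hf x hx).2.1, (hf x hx).2.2.1⟩, fun _ => ⟨hc0', hc1', fun x hx => (hf x hx).2.2.2⟩, fun h => absurd h hj⟩
  choose r hr using hall
  have hrj₀ : r j₀ = r₀ := (hr j₀).2.2.2 rfl
  set p : ℝ := (e₁ : ℝ) + 1 with hp
  set s : ℝ := (e₂ : ℝ) + 1 with hs
  -- shorthand for the rows' tower values
  have hF : ∀ j, ∀ x ∈ Ioo u v, a j 0 - (-(a j 1)) * x ^ (e₁ + 1) - (-(a j 2)) * x ^ (e₁ + e₂ + 2) ≠ 0 :=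
    fun j x hx => ((hr j).2.1 x hx).1
  have hL3 : ∀ j, ∀ x ∈ Ioo u v, rowPsi3 e₁ e₂ (a j 0) (-(a j 1)) (-(a j 2)) x
      = r j ^ 2 * rowPsi1 e₁ e₂ (a j 0) (-(a j 1)) (-(a j 2)) x + 6 * rowPsi1 e₁ e₂ (a j 0) (-(a j 1)) (-(a j 2)) x ^ 2 :=
    fun j x hx => ((hr j).2.1 x hx).2.1
  have hL2 : ∀ j, ∀ x ∈ Ioo u v, rowPsi2 e₁ e₂ (a j 0) (-(a j 1)) (-(a j 2)) x ^ 2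
      = r j ^ 2 * rowPsi1 e₁ e₂ (a j 0) (-(a j 1)) (-(a j 2)) x ^ 2 + 4 * rowPsi1 e₁ e₂ (a j 0) (-(a j 1)) (-(a j 2)) x ^ 3 :=
    fun j x hx => ((hr j).2.1 x hx).2.2
  have hrate : ∀ j, r j = p ∨ r j = s ∨ r j = p + s := fun j => (hr j).1
  have hx0 : ∀ x ∈ Ioo u v, (x : ℝ) ≠ 0 := fun x hx => (hu.trans hx.1).ne'
  -- no row vanishes on the window
  have hf : ∀ x ∈ Ioo u v, ∀ j, (∑ l, C (a j l) * X ^ (d l) : ℝ[X]).eval x ≠ 0 := by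
    intro x hx j
    rw [hev]
    have : a j 0 + a j 1 * x ^ (e₁ + 1) + a j 2 * x ^ (e₁ + e₂ + 2)
        = a j 0 - (-(a j 1)) * x ^ (e₁ + 1) - (-(a j 2)) * x ^ (e₁ + e₂ + 2) := by ring
    rw [this]
    exact mul_ne_zero (pow_ne_zero _ (hx0 x hx)) (hF j x hx)
  -- the zeros of `W` in the window are zeros of `S₀ = Σψ₁`
  have hS0 : ∀ i, (∑ j, rowPsi1 e₁ e₂ (a j 0) (-(a j 1)) (-(a j 2)) (x i)) = 0 := by
    intro i
    have hxi := hxI i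
    have hxpos : 0 < x i := hu.trans hxi.1
    have h := hzero i
    rw [logWronskian_prod_eq_rowPsi1_sum d e₁ e₂ he₁ he₂ a hxpos (hf (x i) hxi)] at h
    have hP : ((∏ j, (∑ l, C (a j l) * X ^ (d l) : ℝ[X])).eval (x i)) ≠ 0 := by
      rw [eval_prod]; exact Finset.prod_ne_zero_iff.2 fun j _ => hf (x i) hxi j
    rcases mul_eq_zero.1 h with h1 | h1
    · exact absurd (neg_eq_zero.1 h1) (pow_ne_zero 2 hP)
    · exact h1
  -- the tower and its derivatives
  have h0 : ∀ x ∈ Ioo u v, HasDerivAt (fun t => ∑ j, rowPsi1 e₁ e₂ (a j 0) (-(a j 1)) (-(a j 2)) t)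
      ((∑ j, rowPsi2 e₁ e₂ (a j 0) (-(a j 1)) (-(a j 2)) x) / x) x := by
    intro x hx
    have h := HasDerivAt.fun_sum (u := Finset.univ)
      (fun j _ => hasDerivAt_rowPsi1 e₁ e₂ (a j 0) (-(a j 1)) (-(a j 2)) (hx0 x hx) (hF j x hx))
    simpa only [Finset.sum_div] using h
  have h1 : ∀ x ∈ Ioo u v, HasDerivAt (fun t => ∑ j, rowPsi2 e₁ e₂ (a j 0) (-(a j 1)) (-(a j 2)) t)
      ((∑ j, (r j ^ 2 * rowPsi1 e₁ e₂ (a j 0) (-(a j 1)) (-(a j 2)) x + 6 * rowPsi1 e₁ e₂ (a j 0) (-(a j 1)) (-(a j 2)) x ^ 2)) / x) x := by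
    intro x hx
    have h := HasDerivAt.fun_sum (u := Finset.univ)
      (fun j _ => hasDerivAt_rowPsi2 e₁ e₂ (a j 0) (-(a j 1)) (-(a j 2)) (hx0 x hx) (hF j x hx))
    refine (h.congr_deriv ?_)
    rw [Finset.sum_div]
    exact Finset.sum_congr rfl (fun j _ => by rw [hL3 j x hx])
  have h2 : ∀ x ∈ Ioo u v, HasDerivAt
      (fun t => ∑ j, (r j ^ 2 * rowPsi1 e₁ e₂ (a j 0) (-(a j 1)) (-(a j 2)) t + 6 * rowPsi1 e₁ e₂ (a j 0) (-(a j 1)) (-(a j 2)) t ^ 2))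
      ((∑ j, (r j ^ 2 + 12 * rowPsi1 e₁ e₂ (a j 0) (-(a j 1)) (-(a j 2)) x) * rowPsi2 e₁ e₂ (a j 0) (-(a j 1)) (-(a j 2)) x) / x) x := by
    intro x hx
    have h := HasDerivAt.fun_sum (u := Finset.univ)
      (fun j _ => hasDerivAt_tower2 e₁ e₂ (a j 0) (-(a j 1)) (-(a j 2)) (r j) (hx0 x hx) (hF j x hx))
    simpa only [Finset.sum_div] using h
  have h3 : ∀ x ∈ Ioo u v, HasDerivAt
      (fun t => ∑ j, (r j ^ 2 + 12 * rowPsi1 e₁ e₂ (a j 0) (-(a j 1)) (-(a j 2)) t) * rowPsi2 e₁ e₂ (a j 0) (-(a j 1)) (-(a j 2)) t)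
      ((∑ j, (r j ^ 4 * rowPsi1 e₁ e₂ (a j 0) (-(a j 1)) (-(a j 2)) x + 30 * r j ^ 2 * rowPsi1 e₁ e₂ (a j 0) (-(a j 1)) (-(a j 2)) x ^ 2 + 120 * rowPsi1 e₁ e₂ (a j 0) (-(a j 1)) (-(a j 2)) x ^ 3)) / x) x := by
    intro x hx
    have h := HasDerivAt.fun_sum (u := Finset.univ)
      (fun j _ => hasDerivAt_tower3 e₁ e₂ (a j 0) (-(a j 1)) (-(a j 2)) (r j) (hx0 x hx) (hF j x hx) (hL2 j x hx) (hL3 j x hx))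
    simpa only [Finset.sum_div] using h
  have h4 : ∀ x ∈ Ioo u v, HasDerivAt
      (fun t => ∑ j, (r j ^ 4 * rowPsi1 e₁ e₂ (a j 0) (-(a j 1)) (-(a j 2)) t + 30 * r j ^ 2 * rowPsi1 e₁ e₂ (a j 0) (-(a j 1)) (-(a j 2)) t ^ 2 + 120 * rowPsi1 e₁ e₂ (a j 0) (-(a j 1)) (-(a j 2)) t ^ 3))
      ((∑ j, (r j ^ 4 + 60 * r j ^ 2 * rowPsi1 e₁ e₂ (a j 0) (-(a j 1)) (-(a j 2)) x + 360 * rowPsi1 e₁ e₂ (a j 0) (-(a j 1)) (-(a j 2)) x ^ 2) * rowPsi2 e₁ e₂ (a j 0) (-(a j 1)) (-(a j 2)) x) / x) x := by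
    intro x hx
    have h := HasDerivAt.fun_sum (u := Finset.univ)
      (fun j _ => hasDerivAt_tower4 e₁ e₂ (a j 0) (-(a j 1)) (-(a j 2)) (r j) (hx0 x hx) (hF j x hx))
    simpa only [Finset.sum_div] using h
  have h5 : ∀ x ∈ Ioo u v, HasDerivAt
      (fun t => ∑ j, (r j ^ 4 + 60 * r j ^ 2 * rowPsi1 e₁ e₂ (a j 0) (-(a j 1)) (-(a j 2)) t + 360 * rowPsi1 e₁ e₂ (a j 0) (-(a j 1)) (-(a j 2)) t ^ 2) * rowPsi2 e₁ e₂ (a j 0) (-(a j 1)) (-(a j 2)) t)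
      ((∑ j, (r j ^ 6 * rowPsi1 e₁ e₂ (a j 0) (-(a j 1)) (-(a j 2)) x + 126 * r j ^ 4 * rowPsi1 e₁ e₂ (a j 0) (-(a j 1)) (-(a j 2)) x ^ 2 + 1680 * r j ^ 2 * rowPsi1 e₁ e₂ (a j 0) (-(a j 1)) (-(a j 2)) x ^ 3 + 5040 * rowPsi1 e₁ e₂ (a j 0) (-(a j 1)) (-(a j 2)) x ^ 4)) / x) x := by
    intro x hx
    have h := HasDerivAt.fun_sum (u := Finset.univ)
      (fun j _ => hasDerivAt_tower5 e₁ e₂ (a j 0) (-(a j 1)) (-(a j 2)) (r j) (hx0 x hx) (hF j x hx) (hL2 j x hx) (hL3 j x hx))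
    simpa only [Finset.sum_div] using h
  -- coefficient abbreviations
  obtain ⟨c0, hc0def⟩ : ∃ c0 : Fin m → ℝ, ∀ j, 6 * (21 * r j ^ 4 - 5 * (p ^ 2 + s ^ 2 + (p + s) ^ 2) * r j ^ 2 + (p ^ 2 * s ^ 2 + p ^ 2 * (p + s) ^ 2 + s ^ 2 * (p + s) ^ 2)) = c0 j := ⟨_, fun j => rfl⟩
  obtain ⟨c1, hc1def⟩ : ∃ c1 : Fin m → ℝ, ∀ j, 120 * (14 * r j ^ 2 - (p ^ 2 + s ^ 2 + (p + s) ^ 2)) = c1 j := ⟨_, fun j => rfl⟩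
  have hc1k : c1 j₀ = 5040 * (L + U) := by rw [← hc1def j₀, hrj₀]; exact hc1r
  have hc0k : c0 j₀ = 5040 * L * U := by rw [← hc0def j₀, hrj₀]; exact hc0r
  have hpoledata : ∀ j, j ≠ j₀ → 0 ≤ c0 j ∧ 0 ≤ c1 j ∧ ∀ y ∈ Ioo u v, 0 < rowPsi1 e₁ e₂ (a j 0) (-(a j 1)) (-(a j 2)) y := by
    intro j hj
    obtain ⟨h0', h1', hpos⟩ := (hr j).2.2.1 hj
    exact ⟨by rw [← hc0def]; exact h0', by rw [← hc1def]; exact h1', hpos⟩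
  have hkneedata : ∀ y ∈ Ioo u v, rowPsi1 e₁ e₂ (a j₀ 0) (-(a j₀ 1)) (-(a j₀ 2)) y < 0 ∧ c0 j₀ + c1 j₀ * rowPsi1 e₁ e₂ (a j₀ 0) (-(a j₀ 1)) (-(a j₀ 2)) y + 5040 * rowPsi1 e₁ e₂ (a j₀ 0) (-(a j₀ 1)) (-(a j₀ 2)) y ^ 2 < 0 := by
    intro y hy
    refine ⟨(hkf y hy).2.2.2.1, ?_⟩
    rw [← hc0def, ← hc1def, hrj₀]
    exact (hkf y hy).2.2.2.2
  -- the order-6 value is `Σ_j (c0_j ψ² + c1_j ψ³ + 5040ψ⁴)`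
  have hq : ((e₁ + e₂ + 1 : ℕ) : ℝ) + 1 = p + s := by rw [hp, hs]; push_cast; ring
  have hval : ∀ y ∈ Ioo u v, (∑ j, (r j ^ 6 * rowPsi1 e₁ e₂ (a j 0) (-(a j 1)) (-(a j 2)) y + 126 * r j ^ 4 * rowPsi1 e₁ e₂ (a j 0) (-(a j 1)) (-(a j 2)) y ^ 2 + 1680 * r j ^ 2 * rowPsi1 e₁ e₂ (a j 0) (-(a j 1)) (-(a j 2)) y ^ 3 + 5040 * rowPsi1 e₁ e₂ (a j 0) (-(a j 1)) (-(a j 2)) y ^ 4))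
      - (p ^ 2 + s ^ 2 + (p + s) ^ 2) * (∑ j, (r j ^ 4 * rowPsi1 e₁ e₂ (a j 0) (-(a j 1)) (-(a j 2)) y + 30 * r j ^ 2 * rowPsi1 e₁ e₂ (a j 0) (-(a j 1)) (-(a j 2)) y ^ 2 + 120 * rowPsi1 e₁ e₂ (a j 0) (-(a j 1)) (-(a j 2)) y ^ 3))
      + (p ^ 2 * s ^ 2 + p ^ 2 * (p + s) ^ 2 + s ^ 2 * (p + s) ^ 2) * (∑ j, (r j ^ 2 * rowPsi1 e₁ e₂ (a j 0) (-(a j 1)) (-(a j 2)) y + 6 * rowPsi1 e₁ e₂ (a j 0) (-(a j 1)) (-(a j 2)) y ^ 2)) - p ^ 2 * s ^ 2 * (p + s) ^ 2 * (∑ j, rowPsi1 e₁ e₂ (a j 0) (-(a j 1)) (-(a j 2)) y)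
      = ∑ j, (c0 j * rowPsi1 e₁ e₂ (a j 0) (-(a j 1)) (-(a j 2)) y ^ 2 + c1 j * rowPsi1 e₁ e₂ (a j 0) (-(a j 1)) (-(a j 2)) y ^ 3 + 5040 * rowPsi1 e₁ e₂ (a j 0) (-(a j 1)) (-(a j 2)) y ^ 4) := by
    intro y hy
    rw [Finset.mul_sum, Finset.mul_sum, Finset.mul_sum, ← Finset.sum_sub_distrib, ← Finset.sum_add_distrib, ← Finset.sum_sub_distrib]
    refine Finset.sum_congr rfl (fun j _ => ?_)
    have h := sixthOrder_row_value p s (r j) (rowPsi1 e₁ e₂ (a j 0) (-(a j 1)) (-(a j 2)) y) (hrate j)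
    rw [← hc0def j, ← hc1def j]
    linear_combination h
  rw [hp, hs] at hval
  refine no_chain_of_sixth_order_law_defects e₁ e₂ (e₁ + e₂ + 1) 2 hu.le h0 h1 h2 h3 h4 h5 ?_ x hx hxI hS0
  intro w hw hwI hallw
  have hzero3 : ∀ i, ∑ j, (c0 j * rowPsi1 e₁ e₂ (a j 0) (-(a j 1)) (-(a j 2)) (w i) ^ 2 + c1 j * rowPsi1 e₁ e₂ (a j 0) (-(a j 1)) (-(a j 2)) (w i) ^ 3 + 5040 * rowPsi1 e₁ e₂ (a j 0) (-(a j 1)) (-(a j 2)) (w i) ^ 4) = 0 := by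
    intro i
    have h := hallw i
    rw [hq, hp, hs, hval (w i) (hwI i)] at h
    exact h
  -- signs of the images
  have hbneg : ∀ y ∈ Ioo u v, c0 j₀ * rowPsi1 e₁ e₂ (a j₀ 0) (-(a j₀ 1)) (-(a j₀ 2)) y ^ 2 + c1 j₀ * rowPsi1 e₁ e₂ (a j₀ 0) (-(a j₀ 1)) (-(a j₀ 2)) y ^ 3 + 5040 * rowPsi1 e₁ e₂ (a j₀ 0) (-(a j₀ 1)) (-(a j₀ 2)) y ^ 4 < 0 := by
    intro y hy
    obtain ⟨hψ, hbr⟩ := hkneedata y hy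
    have hψne : rowPsi1 e₁ e₂ (a j₀ 0) (-(a j₀ 1)) (-(a j₀ 2)) y ≠ 0 := hψ.ne
    have hψ2 : 0 < rowPsi1 e₁ e₂ (a j₀ 0) (-(a j₀ 1)) (-(a j₀ 2)) y ^ 2 := by positivity
    have : c0 j₀ * rowPsi1 e₁ e₂ (a j₀ 0) (-(a j₀ 1)) (-(a j₀ 2)) y ^ 2 + c1 j₀ * rowPsi1 e₁ e₂ (a j₀ 0) (-(a j₀ 1)) (-(a j₀ 2)) y ^ 3 + 5040 * rowPsi1 e₁ e₂ (a j₀ 0) (-(a j₀ 1)) (-(a j₀ 2)) y ^ 4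
        = rowPsi1 e₁ e₂ (a j₀ 0) (-(a j₀ 1)) (-(a j₀ 2)) y ^ 2 * (c0 j₀ + c1 j₀ * rowPsi1 e₁ e₂ (a j₀ 0) (-(a j₀ 1)) (-(a j₀ 2)) y + 5040 * rowPsi1 e₁ e₂ (a j₀ 0) (-(a j₀ 1)) (-(a j₀ 2)) y ^ 2) := by ring
    rw [this]
    exact mul_neg_of_pos_of_neg hψ2 hbr
  have hbpos : ∀ j, j ≠ j₀ → ∀ y ∈ Ioo u v, 0 < c0 j * rowPsi1 e₁ e₂ (a j 0) (-(a j 1)) (-(a j 2)) y ^ 2 + c1 j * rowPsi1 e₁ e₂ (a j 0) (-(a j 1)) (-(a j 2)) y ^ 3 + 5040 * rowPsi1 e₁ e₂ (a j 0) (-(a j 1)) (-(a j 2)) y ^ 4 := by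
    intro j hj y hy
    obtain ⟨h0', h1', hpos⟩ := hpoledata j hj
    have hψ := hpos y hy
    positivity
  -- the company with the knee alone: `G = −β̃ < 0` never vanishes
  by_cases hm1 : (Finset.univ.erase j₀ : Finset (Fin m)) = ∅
  · have h := hzero3 0
    rw [← Finset.add_sum_erase _ _ (Finset.mem_univ j₀), hm1, Finset.sum_empty, add_zero] at h
    exact absurd h (hbneg (w 0) (hwI 0)).ne
  have hne : (Finset.univ.erase j₀ : Finset (Fin m)).Nonempty := Finset.nonempty_iff_ne_empty.2 hm1
  -- θ-towers of A := −(knee image) and G := Σ (pole images)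
  have hA : ∀ y ∈ Ioo u v, HasDerivAt (fun t => -(c0 j₀ * rowPsi1 e₁ e₂ (a j₀ 0) (-(a j₀ 1)) (-(a j₀ 2)) t ^ 2 + c1 j₀ * rowPsi1 e₁ e₂ (a j₀ 0) (-(a j₀ 1)) (-(a j₀ 2)) t ^ 3 + 5040 * rowPsi1 e₁ e₂ (a j₀ 0) (-(a j₀ 1)) (-(a j₀ 2)) t ^ 4))
      ((-((2 * c0 j₀ * rowPsi1 e₁ e₂ (a j₀ 0) (-(a j₀ 1)) (-(a j₀ 2)) y + 3 * c1 j₀ * rowPsi1 e₁ e₂ (a j₀ 0) (-(a j₀ 1)) (-(a j₀ 2)) y ^ 2 + 20160 * rowPsi1 e₁ e₂ (a j₀ 0) (-(a j₀ 1)) (-(a j₀ 2)) y ^ 3) * rowPsi2 e₁ e₂ (a j₀ 0) (-(a j₀ 1)) (-(a j₀ 2)) y)) / y) y := by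
    intro y hy
    have h := (hasDerivAt_image e₁ e₂ (a j₀ 0) (-(a j₀ 1)) (-(a j₀ 2)) (c0 j₀) (c1 j₀) (hx0 y hy) (hF j₀ y hy)).neg
    refine h.congr_deriv ?_
    rw [neg_div]
  have hA₁ : ∀ y ∈ Ioo u v, HasDerivAt (fun t => -((2 * c0 j₀ * rowPsi1 e₁ e₂ (a j₀ 0) (-(a j₀ 1)) (-(a j₀ 2)) t + 3 * c1 j₀ * rowPsi1 e₁ e₂ (a j₀ 0) (-(a j₀ 1)) (-(a j₀ 2)) t ^ 2 + 20160 * rowPsi1 e₁ e₂ (a j₀ 0) (-(a j₀ 1)) (-(a j₀ 2)) t ^ 3) * rowPsi2 e₁ e₂ (a j₀ 0) (-(a j₀ 1)) (-(a j₀ 2)) t))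
      ((-((2 * c0 j₀ + 6 * c1 j₀ * rowPsi1 e₁ e₂ (a j₀ 0) (-(a j₀ 1)) (-(a j₀ 2)) y + 60480 * rowPsi1 e₁ e₂ (a j₀ 0) (-(a j₀ 1)) (-(a j₀ 2)) y ^ 2) * (r j₀ ^ 2 * rowPsi1 e₁ e₂ (a j₀ 0) (-(a j₀ 1)) (-(a j₀ 2)) y ^ 2 + 4 * rowPsi1 e₁ e₂ (a j₀ 0) (-(a j₀ 1)) (-(a j₀ 2)) y ^ 3)
              + (2 * c0 j₀ * rowPsi1 e₁ e₂ (a j₀ 0) (-(a j₀ 1)) (-(a j₀ 2)) y + 3 * c1 j₀ * rowPsi1 e₁ e₂ (a j₀ 0) (-(a j₀ 1)) (-(a j₀ 2)) y ^ 2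
              + 20160 * rowPsi1 e₁ e₂ (a j₀ 0) (-(a j₀ 1)) (-(a j₀ 2)) y ^ 3) * (r j₀ ^ 2 * rowPsi1 e₁ e₂ (a j₀ 0) (-(a j₀ 1)) (-(a j₀ 2)) y + 6 * rowPsi1 e₁ e₂ (a j₀ 0) (-(a j₀ 1)) (-(a j₀ 2)) y ^ 2))) / y) y := by
    intro y hy
    have h := (hasDerivAt_image1 e₁ e₂ (a j₀ 0) (-(a j₀ 1)) (-(a j₀ 2)) (c0 j₀) (c1 j₀) (r j₀) (hx0 y hy) (hF j₀ y hy)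
      (hL2 j₀ y hy) (hL3 j₀ y hy)).neg
    refine h.congr_deriv ?_
    rw [neg_div]
  have hG : ∀ y ∈ Ioo u v, HasDerivAt (fun t => ∑ j ∈ Finset.univ.erase j₀, (c0 j * rowPsi1 e₁ e₂ (a j 0) (-(a j 1)) (-(a j 2)) t ^ 2 + c1 j * rowPsi1 e₁ e₂ (a j 0) (-(a j 1)) (-(a j 2)) t ^ 3 + 5040 * rowPsi1 e₁ e₂ (a j 0) (-(a j 1)) (-(a j 2)) t ^ 4))
      ((∑ j ∈ Finset.univ.erase j₀, (2 * c0 j * rowPsi1 e₁ e₂ (a j 0) (-(a j 1)) (-(a j 2)) y + 3 * c1 j * rowPsi1 e₁ e₂ (a j 0) (-(a j 1)) (-(a j 2)) y ^ 2 + 20160 * rowPsi1 e₁ e₂ (a j 0) (-(a j 1)) (-(a j 2)) y ^ 3) * rowPsi2 e₁ e₂ (a j 0) (-(a j 1)) (-(a j 2)) y) / y) y := by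
    intro y hy
    have h := HasDerivAt.fun_sum (u := Finset.univ.erase j₀)
      (fun j _ => hasDerivAt_image e₁ e₂ (a j 0) (-(a j 1)) (-(a j 2)) (c0 j) (c1 j) (hx0 y hy) (hF j y hy))
    simpa only [Finset.sum_div] using h
  have hG₁ : ∀ y ∈ Ioo u v, HasDerivAt (fun t => ∑ j ∈ Finset.univ.erase j₀, (2 * c0 j * rowPsi1 e₁ e₂ (a j 0) (-(a j 1)) (-(a j 2)) t + 3 * c1 j * rowPsi1 e₁ e₂ (a j 0) (-(a j 1)) (-(a j 2)) t ^ 2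
          + 20160 * rowPsi1 e₁ e₂ (a j 0) (-(a j 1)) (-(a j 2)) t ^ 3) * rowPsi2 e₁ e₂ (a j 0) (-(a j 1)) (-(a j 2)) t)
      ((∑ j ∈ Finset.univ.erase j₀, ((2 * c0 j + 6 * c1 j * rowPsi1 e₁ e₂ (a j 0) (-(a j 1)) (-(a j 2)) y + 60480 * rowPsi1 e₁ e₂ (a j 0) (-(a j 1)) (-(a j 2)) y ^ 2) * (r j ^ 2 * rowPsi1 e₁ e₂ (a j 0) (-(a j 1)) (-(a j 2)) y ^ 2
              + 4 * rowPsi1 e₁ e₂ (a j 0) (-(a j 1)) (-(a j 2)) y ^ 3) + (2 * c0 j * rowPsi1 e₁ e₂ (a j 0) (-(a j 1)) (-(a j 2)) y + 3 * c1 j * rowPsi1 e₁ e₂ (a j 0) (-(a j 1)) (-(a j 2)) y ^ 2 + 20160 * rowPsi1 e₁ e₂ (a j 0) (-(a j 1)) (-(a j 2)) y ^ 3)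
              * (r j ^ 2 * rowPsi1 e₁ e₂ (a j 0) (-(a j 1)) (-(a j 2)) y + 6 * rowPsi1 e₁ e₂ (a j 0) (-(a j 1)) (-(a j 2)) y ^ 2))) / y) y := by
    intro y hy
    have h := HasDerivAt.fun_sum (u := Finset.univ.erase j₀)
      (fun j _ => hasDerivAt_image1 e₁ e₂ (a j 0) (-(a j 1)) (-(a j 2)) (c0 j) (c1 j) (r j) (hx0 y hy) (hF j y hy) (hL2 j y hy) (hL3 j y hy))
    simpa only [Finset.sum_div] using h
  have hApos : ∀ y ∈ Ioo u v, 0 < -(c0 j₀ * rowPsi1 e₁ e₂ (a j₀ 0) (-(a j₀ 1)) (-(a j₀ 2)) y ^ 2 + c1 j₀ * rowPsi1 e₁ e₂ (a j₀ 0) (-(a j₀ 1)) (-(a j₀ 2)) y ^ 3 + 5040 * rowPsi1 e₁ e₂ (a j₀ 0) (-(a j₀ 1)) (-(a j₀ 2)) y ^ 4) := fun y hy => by linarith [hbneg y hy]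
  have hGpos : ∀ y ∈ Ioo u v, 0 < ∑ j ∈ Finset.univ.erase j₀, (c0 j * rowPsi1 e₁ e₂ (a j 0) (-(a j 1)) (-(a j 2)) y ^ 2 + c1 j * rowPsi1 e₁ e₂ (a j 0) (-(a j 1)) (-(a j 2)) y ^ 3 + 5040 * rowPsi1 e₁ e₂ (a j 0) (-(a j 1)) (-(a j 2)) y ^ 4) :=
    fun y hy => Finset.sum_pos (fun j hj => hbpos j (Finset.ne_of_mem_erase hj) y hy) hne
  have h01 : (0 : Fin 3) < 1 := by decide
  have h12 : (1 : Fin 3) < 2 := by decide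
  refine no_three_zeros_of_logCurvature_margin hu.le hA hA₁ hG hG₁ hApos hGpos ?_ (hwI 0) (hwI 2) (hw h01) (hw h12) ?_ ?_ ?_
  · -- the curvature margin: knee image strictly log-concave (Bernstein), pole images log-convex (termwise)
    intro y hy
    obtain ⟨hψ, hbr⟩ := hkneedata y hy
    -- ring band: L < −ψ < U
    rw [hc0k, hc1k] at hbr
    have hprod : (rowPsi1 e₁ e₂ (a j₀ 0) (-(a j₀ 1)) (-(a j₀ 2)) y + L) * (rowPsi1 e₁ e₂ (a j₀ 0) (-(a j₀ 1)) (-(a j₀ 2)) y + U) < 0 := by nlinarith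
    obtain ⟨hYL, hYU⟩ : L < -rowPsi1 e₁ e₂ (a j₀ 0) (-(a j₀ 1)) (-(a j₀ 2)) y ∧ -rowPsi1 e₁ e₂ (a j₀ 0) (-(a j₀ 1)) (-(a j₀ 2)) y < U := by
      rcases mul_neg_iff.mp hprod with ⟨h1, h2⟩ | ⟨h1, h2⟩
      · exfalso; linarith
      · constructor <;> linarith
    have h4U' : 4 * U ≤ r j₀ ^ 2 := by rw [hrj₀]; exact h4U
    have hΦ : 0 < (203212800 * rowPsi1 e₁ e₂ (a j₀ 0) (-(a j₀ 1)) (-(a j₀ 2)) y ^ 4 + 90720 * c1 j₀ * rowPsi1 e₁ e₂ (a j₀ 0) (-(a j₀ 1)) (-(a j₀ 2)) y ^ 3 + (6 * c1 j₀ ^ 2 + 5040 * c1 j₀ * r j₀ ^ 2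
            + 141120 * c0 j₀) * rowPsi1 e₁ e₂ (a j₀ 0) (-(a j₀ 1)) (-(a j₀ 2)) y ^ 2 + (14 * c0 j₀ * c1 j₀ + 20160 * c0 j₀ * r j₀ ^ 2) * rowPsi1 e₁ e₂ (a j₀ 0) (-(a j₀ 1)) (-(a j₀ 2)) y + (4 * c0 j₀ ^ 2 + c0 j₀ * c1 j₀ * r j₀ ^ 2)) := by
      rw [hc0k, hc1k]
      have h := bernstein_knee_pos (R := r j₀ ^ 2) (Y := -rowPsi1 e₁ e₂ (a j₀ 0) (-(a j₀ 1)) (-(a j₀ 2)) y) hL hLU h4U' hYL hYU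
      simp only [neg_neg] at h
      exact h
    have hψ5 : rowPsi1 e₁ e₂ (a j₀ 0) (-(a j₀ 1)) (-(a j₀ 2)) y ^ 5 < 0 := by
      have : rowPsi1 e₁ e₂ (a j₀ 0) (-(a j₀ 1)) (-(a j₀ 2)) y ^ 5 = rowPsi1 e₁ e₂ (a j₀ 0) (-(a j₀ 1)) (-(a j₀ 2)) y ^ 4 * rowPsi1 e₁ e₂ (a j₀ 0) (-(a j₀ 1)) (-(a j₀ 2)) y := by ring
      rw [this]
      have hψne : rowPsi1 e₁ e₂ (a j₀ 0) (-(a j₀ 1)) (-(a j₀ 2)) y ≠ 0 := hψ.ne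
      exact mul_neg_of_pos_of_neg (by positivity) hψ
    have keyA := image_curvature_identity (c0 j₀) (c1 j₀) (r j₀ ^ 2) (rowPsi1 e₁ e₂ (a j₀ 0) (-(a j₀ 1)) (-(a j₀ 2)) y)
    have h2A := hL2 j₀ y hy
    have hN : (-(c0 j₀ * rowPsi1 e₁ e₂ (a j₀ 0) (-(a j₀ 1)) (-(a j₀ 2)) y ^ 2 + c1 j₀ * rowPsi1 e₁ e₂ (a j₀ 0) (-(a j₀ 1)) (-(a j₀ 2)) y ^ 3 + 5040 * rowPsi1 e₁ e₂ (a j₀ 0) (-(a j₀ 1)) (-(a j₀ 2)) y ^ 4)) * (-((2 * c0 j₀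
            + 6 * c1 j₀ * rowPsi1 e₁ e₂ (a j₀ 0) (-(a j₀ 1)) (-(a j₀ 2)) y + 60480 * rowPsi1 e₁ e₂ (a j₀ 0) (-(a j₀ 1)) (-(a j₀ 2)) y ^ 2) * (r j₀ ^ 2 * rowPsi1 e₁ e₂ (a j₀ 0) (-(a j₀ 1)) (-(a j₀ 2)) y ^ 2 + 4 * rowPsi1 e₁ e₂ (a j₀ 0) (-(a j₀ 1)) (-(a j₀ 2)) y ^ 3)
            + (2 * c0 j₀ * rowPsi1 e₁ e₂ (a j₀ 0) (-(a j₀ 1)) (-(a j₀ 2)) y + 3 * c1 j₀ * rowPsi1 e₁ e₂ (a j₀ 0) (-(a j₀ 1)) (-(a j₀ 2)) y ^ 2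
            + 20160 * rowPsi1 e₁ e₂ (a j₀ 0) (-(a j₀ 1)) (-(a j₀ 2)) y ^ 3) * (r j₀ ^ 2 * rowPsi1 e₁ e₂ (a j₀ 0) (-(a j₀ 1)) (-(a j₀ 2)) y + 6 * rowPsi1 e₁ e₂ (a j₀ 0) (-(a j₀ 1)) (-(a j₀ 2)) y ^ 2)))
        - (-((2 * c0 j₀ * rowPsi1 e₁ e₂ (a j₀ 0) (-(a j₀ 1)) (-(a j₀ 2)) y + 3 * c1 j₀ * rowPsi1 e₁ e₂ (a j₀ 0) (-(a j₀ 1)) (-(a j₀ 2)) y ^ 2 + 20160 * rowPsi1 e₁ e₂ (a j₀ 0) (-(a j₀ 1)) (-(a j₀ 2)) y ^ 3) * rowPsi2 e₁ e₂ (a j₀ 0) (-(a j₀ 1)) (-(a j₀ 2)) y)) ^ 2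
        = rowPsi1 e₁ e₂ (a j₀ 0) (-(a j₀ 1)) (-(a j₀ 2)) y ^ 5 * (203212800 * rowPsi1 e₁ e₂ (a j₀ 0) (-(a j₀ 1)) (-(a j₀ 2)) y ^ 4
                + 90720 * c1 j₀ * rowPsi1 e₁ e₂ (a j₀ 0) (-(a j₀ 1)) (-(a j₀ 2)) y ^ 3 + (6 * c1 j₀ ^ 2 + 5040 * c1 j₀ * r j₀ ^ 2 + 141120 * c0 j₀) * rowPsi1 e₁ e₂ (a j₀ 0) (-(a j₀ 1)) (-(a j₀ 2)) y ^ 2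
        + (14 * c0 j₀ * c1 j₀ + 20160 * c0 j₀ * r j₀ ^ 2) * rowPsi1 e₁ e₂ (a j₀ 0) (-(a j₀ 1)) (-(a j₀ 2)) y + (4 * c0 j₀ ^ 2 + c0 j₀ * c1 j₀ * r j₀ ^ 2)) := by
      linear_combination keyA - (2 * c0 j₀ * rowPsi1 e₁ e₂ (a j₀ 0) (-(a j₀ 1)) (-(a j₀ 2)) y + 3 * c1 j₀ * rowPsi1 e₁ e₂ (a j₀ 0) (-(a j₀ 1)) (-(a j₀ 2)) y ^ 2 + 20160 * rowPsi1 e₁ e₂ (a j₀ 0) (-(a j₀ 1)) (-(a j₀ 2)) y ^ 3) ^ 2 * h2A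
    have hNneg : (-(c0 j₀ * rowPsi1 e₁ e₂ (a j₀ 0) (-(a j₀ 1)) (-(a j₀ 2)) y ^ 2 + c1 j₀ * rowPsi1 e₁ e₂ (a j₀ 0) (-(a j₀ 1)) (-(a j₀ 2)) y ^ 3 + 5040 * rowPsi1 e₁ e₂ (a j₀ 0) (-(a j₀ 1)) (-(a j₀ 2)) y ^ 4)) * (-((2 * c0 j₀
            + 6 * c1 j₀ * rowPsi1 e₁ e₂ (a j₀ 0) (-(a j₀ 1)) (-(a j₀ 2)) y + 60480 * rowPsi1 e₁ e₂ (a j₀ 0) (-(a j₀ 1)) (-(a j₀ 2)) y ^ 2) * (r j₀ ^ 2 * rowPsi1 e₁ e₂ (a j₀ 0) (-(a j₀ 1)) (-(a j₀ 2)) y ^ 2 + 4 * rowPsi1 e₁ e₂ (a j₀ 0) (-(a j₀ 1)) (-(a j₀ 2)) y ^ 3)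
            + (2 * c0 j₀ * rowPsi1 e₁ e₂ (a j₀ 0) (-(a j₀ 1)) (-(a j₀ 2)) y + 3 * c1 j₀ * rowPsi1 e₁ e₂ (a j₀ 0) (-(a j₀ 1)) (-(a j₀ 2)) y ^ 2
            + 20160 * rowPsi1 e₁ e₂ (a j₀ 0) (-(a j₀ 1)) (-(a j₀ 2)) y ^ 3) * (r j₀ ^ 2 * rowPsi1 e₁ e₂ (a j₀ 0) (-(a j₀ 1)) (-(a j₀ 2)) y + 6 * rowPsi1 e₁ e₂ (a j₀ 0) (-(a j₀ 1)) (-(a j₀ 2)) y ^ 2)))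
        - (-((2 * c0 j₀ * rowPsi1 e₁ e₂ (a j₀ 0) (-(a j₀ 1)) (-(a j₀ 2)) y + 3 * c1 j₀ * rowPsi1 e₁ e₂ (a j₀ 0) (-(a j₀ 1)) (-(a j₀ 2)) y ^ 2 + 20160 * rowPsi1 e₁ e₂ (a j₀ 0) (-(a j₀ 1)) (-(a j₀ 2)) y ^ 3) * rowPsi2 e₁ e₂ (a j₀ 0) (-(a j₀ 1)) (-(a j₀ 2)) y)) ^ 2 < 0 := by
      rw [hN]; exact mul_neg_of_neg_of_pos hψ5 hΦ
    -- poles: termwise log-convexity summed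
    have hGG : 0 ≤ (∑ j ∈ Finset.univ.erase j₀, (c0 j * rowPsi1 e₁ e₂ (a j 0) (-(a j 1)) (-(a j 2)) y ^ 2 + c1 j * rowPsi1 e₁ e₂ (a j 0) (-(a j 1)) (-(a j 2)) y ^ 3 + 5040 * rowPsi1 e₁ e₂ (a j 0) (-(a j 1)) (-(a j 2)) y ^ 4))
            * (∑ j ∈ Finset.univ.erase j₀, ((2 * c0 j + 6 * c1 j * rowPsi1 e₁ e₂ (a j 0) (-(a j 1)) (-(a j 2)) y + 60480 * rowPsi1 e₁ e₂ (a j 0) (-(a j 1)) (-(a j 2)) y ^ 2) * (r j ^ 2 * rowPsi1 e₁ e₂ (a j 0) (-(a j 1)) (-(a j 2)) y ^ 2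
            + 4 * rowPsi1 e₁ e₂ (a j 0) (-(a j 1)) (-(a j 2)) y ^ 3) + (2 * c0 j * rowPsi1 e₁ e₂ (a j 0) (-(a j 1)) (-(a j 2)) y + 3 * c1 j * rowPsi1 e₁ e₂ (a j 0) (-(a j 1)) (-(a j 2)) y ^ 2 + 20160 * rowPsi1 e₁ e₂ (a j 0) (-(a j 1)) (-(a j 2)) y ^ 3)
            * (r j ^ 2 * rowPsi1 e₁ e₂ (a j 0) (-(a j 1)) (-(a j 2)) y + 6 * rowPsi1 e₁ e₂ (a j 0) (-(a j 1)) (-(a j 2)) y ^ 2))) - (∑ j ∈ Finset.univ.erase j₀, (2 * c0 j * rowPsi1 e₁ e₂ (a j 0) (-(a j 1)) (-(a j 2)) y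
                + 3 * c1 j * rowPsi1 e₁ e₂ (a j 0) (-(a j 1)) (-(a j 2)) y ^ 2 + 20160 * rowPsi1 e₁ e₂ (a j 0) (-(a j 1)) (-(a j 2)) y ^ 3) * rowPsi2 e₁ e₂ (a j 0) (-(a j 1)) (-(a j 2)) y) ^ 2 := by
      have h := replicator_curvature_bound (Finset.univ.erase j₀) (fun j => (c0 j * rowPsi1 e₁ e₂ (a j 0) (-(a j 1)) (-(a j 2)) y ^ 2 + c1 j * rowPsi1 e₁ e₂ (a j 0) (-(a j 1)) (-(a j 2)) y ^ 3 + 5040 * rowPsi1 e₁ e₂ (a j 0) (-(a j 1)) (-(a j 2)) y ^ 4))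
        (fun j => (2 * c0 j * rowPsi1 e₁ e₂ (a j 0) (-(a j 1)) (-(a j 2)) y + 3 * c1 j * rowPsi1 e₁ e₂ (a j 0) (-(a j 1)) (-(a j 2)) y ^ 2 + 20160 * rowPsi1 e₁ e₂ (a j 0) (-(a j 1)) (-(a j 2)) y ^ 3) * rowPsi2 e₁ e₂ (a j 0) (-(a j 1)) (-(a j 2)) y) (fun j => ((2 * c0 j
                + 6 * c1 j * rowPsi1 e₁ e₂ (a j 0) (-(a j 1)) (-(a j 2)) y + 60480 * rowPsi1 e₁ e₂ (a j 0) (-(a j 1)) (-(a j 2)) y ^ 2) * (r j ^ 2 * rowPsi1 e₁ e₂ (a j 0) (-(a j 1)) (-(a j 2)) y ^ 2 + 4 * rowPsi1 e₁ e₂ (a j 0) (-(a j 1)) (-(a j 2)) y ^ 3)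
                + (2 * c0 j * rowPsi1 e₁ e₂ (a j 0) (-(a j 1)) (-(a j 2)) y + 3 * c1 j * rowPsi1 e₁ e₂ (a j 0) (-(a j 1)) (-(a j 2)) y ^ 2
                + 20160 * rowPsi1 e₁ e₂ (a j 0) (-(a j 1)) (-(a j 2)) y ^ 3) * (r j ^ 2 * rowPsi1 e₁ e₂ (a j 0) (-(a j 1)) (-(a j 2)) y + 6 * rowPsi1 e₁ e₂ (a j 0) (-(a j 1)) (-(a j 2)) y ^ 2))) 0
        (fun j hj => hbpos j (Finset.ne_of_mem_erase hj) y hy) (fun j hj => by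
          obtain ⟨h0', h1', hpos⟩ := hpoledata j (Finset.ne_of_mem_erase hj)
          have hψ := hpos y hy
          have keyj := image_curvature_identity (c0 j) (c1 j) (r j ^ 2) (rowPsi1 e₁ e₂ (a j 0) (-(a j 1)) (-(a j 2)) y)
          have h2j := hL2 j y hy
          have hNj : (c0 j * rowPsi1 e₁ e₂ (a j 0) (-(a j 1)) (-(a j 2)) y ^ 2 + c1 j * rowPsi1 e₁ e₂ (a j 0) (-(a j 1)) (-(a j 2)) y ^ 3 + 5040 * rowPsi1 e₁ e₂ (a j 0) (-(a j 1)) (-(a j 2)) y ^ 4) * ((2 * c0 j + 6 * c1 j * rowPsi1 e₁ e₂ (a j 0) (-(a j 1)) (-(a j 2)) y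
                  + 60480 * rowPsi1 e₁ e₂ (a j 0) (-(a j 1)) (-(a j 2)) y ^ 2) * (r j ^ 2 * rowPsi1 e₁ e₂ (a j 0) (-(a j 1)) (-(a j 2)) y ^ 2 + 4 * rowPsi1 e₁ e₂ (a j 0) (-(a j 1)) (-(a j 2)) y ^ 3) + (2 * c0 j * rowPsi1 e₁ e₂ (a j 0) (-(a j 1)) (-(a j 2)) y
                  + 3 * c1 j * rowPsi1 e₁ e₂ (a j 0) (-(a j 1)) (-(a j 2)) y ^ 2 + 20160 * rowPsi1 e₁ e₂ (a j 0) (-(a j 1)) (-(a j 2)) y ^ 3) * (r j ^ 2 * rowPsi1 e₁ e₂ (a j 0) (-(a j 1)) (-(a j 2)) y + 6 * rowPsi1 e₁ e₂ (a j 0) (-(a j 1)) (-(a j 2)) y ^ 2))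
                  - ((2 * c0 j * rowPsi1 e₁ e₂ (a j 0) (-(a j 1)) (-(a j 2)) y + 3 * c1 j * rowPsi1 e₁ e₂ (a j 0) (-(a j 1)) (-(a j 2)) y ^ 2 + 20160 * rowPsi1 e₁ e₂ (a j 0) (-(a j 1)) (-(a j 2)) y ^ 3) * rowPsi2 e₁ e₂ (a j 0) (-(a j 1)) (-(a j 2)) y) ^ 2
              = rowPsi1 e₁ e₂ (a j 0) (-(a j 1)) (-(a j 2)) y ^ 5 * (203212800 * rowPsi1 e₁ e₂ (a j 0) (-(a j 1)) (-(a j 2)) y ^ 4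
                      + 90720 * c1 j * rowPsi1 e₁ e₂ (a j 0) (-(a j 1)) (-(a j 2)) y ^ 3 + (6 * c1 j ^ 2 + 5040 * c1 j * r j ^ 2 + 141120 * c0 j) * rowPsi1 e₁ e₂ (a j 0) (-(a j 1)) (-(a j 2)) y ^ 2
        + (14 * c0 j * c1 j + 20160 * c0 j * r j ^ 2) * rowPsi1 e₁ e₂ (a j 0) (-(a j 1)) (-(a j 2)) y + (4 * c0 j ^ 2 + c0 j * c1 j * r j ^ 2)) := by
            linear_combination keyj - (2 * c0 j * rowPsi1 e₁ e₂ (a j 0) (-(a j 1)) (-(a j 2)) y + 3 * c1 j * rowPsi1 e₁ e₂ (a j 0) (-(a j 1)) (-(a j 2)) y ^ 2 + 20160 * rowPsi1 e₁ e₂ (a j 0) (-(a j 1)) (-(a j 2)) y ^ 3) ^ 2 * h2j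
          rw [neg_zero, zero_mul, hNj]
          exact image_curvature_pole_nonneg h0' h1' (sq_nonneg _) hψ)
      simpa using h
    have hG2 : 0 < (∑ j ∈ Finset.univ.erase j₀, (c0 j * rowPsi1 e₁ e₂ (a j 0) (-(a j 1)) (-(a j 2)) y ^ 2 + c1 j * rowPsi1 e₁ e₂ (a j 0) (-(a j 1)) (-(a j 2)) y ^ 3 + 5040 * rowPsi1 e₁ e₂ (a j 0) (-(a j 1)) (-(a j 2)) y ^ 4)) ^ 2 := pow_pos (hGpos y hy) 2
    have hlhs := mul_neg_of_neg_of_pos hNneg hG2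
    have hrhs := mul_nonneg hGG (sq_nonneg (-(c0 j₀ * rowPsi1 e₁ e₂ (a j₀ 0) (-(a j₀ 1)) (-(a j₀ 2)) y ^ 2 + c1 j₀ * rowPsi1 e₁ e₂ (a j₀ 0) (-(a j₀ 1)) (-(a j₀ 2)) y ^ 3 + 5040 * rowPsi1 e₁ e₂ (a j₀ 0) (-(a j₀ 1)) (-(a j₀ 2)) y ^ 4)))
    exact hlhs.trans_le hrhs
  · have h := hzero3 0
    rw [← Finset.add_sum_erase _ _ (Finset.mem_univ j₀)] at h
    linarith
  · have h := hzero3 1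
    rw [← Finset.add_sum_erase _ _ (Finset.mem_univ j₀)] at h
    linarith
  · have h := hzero3 2
    rw [← Finset.add_sum_erase _ _ (Finset.mem_univ j₀)] at h
    linarith

/-- ★★ **RING-ISO AGAINST POLES, count form**: under the same hypotheses `W(∏_j f_j)` has AT MOST EIGHT roots in `(u,v)`. [this file's theorem] -/
theorem ringIsoPoles_wronskian_roots_le_eight {m : ℕ} (d : Fin 3 → ℕ) (e₁ e₂ : ℕ) (he₁ : d 1 = d 0 + e₁ + 1)
    (he₂ : d 2 = d 1 + e₂ + 1) (h2p : 2 * (e₁ + 1) ≤ e₂ + 1) (a : Fin m → Fin 3 → ℝ) {u v : ℝ} (hu : 0 < u) (j₀ : Fin m)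
    (hknee :
      (a j₀ 0 = 0 ∧ 0 < a j₀ 1 * a j₀ 2 ∧ ∀ x ∈ Ioo u v, 6 * ((((e₂ : ℝ) + 1) - ((e₁ : ℝ) + 1)) * (2 * ((e₂ : ℝ) + 1) - ((e₁ : ℝ) + 1)) * (2 * ((e₂ : ℝ) + 1) + ((e₁ : ℝ) + 1)) * (3 * ((e₂ : ℝ) + 1) + ((e₁ : ℝ) + 1)))
            + 240 * ((3 * ((e₂ : ℝ) + 1) + ((e₁ : ℝ) + 1)) * (2 * ((e₂ : ℝ) + 1) - ((e₁ : ℝ) + 1))) * rowPsi1 e₁ e₂ (a j₀ 0) (-(a j₀ 1)) (-(a j₀ 2)) x + 5040 * rowPsi1 e₁ e₂ (a j₀ 0) (-(a j₀ 1)) (-(a j₀ 2)) x ^ 2 < 0) ∨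
      (a j₀ 1 = 0 ∧ 0 < a j₀ 0 * a j₀ 2 ∧ ∀ x ∈ Ioo u v, 6 * (12 * ((e₁ : ℝ) + 1) ^ 4 + 56 * ((e₁ : ℝ) + 1) ^ 3 * ((e₂ : ℝ) + 1) + 89 * ((e₁ : ℝ) + 1) ^ 2 * ((e₂ : ℝ) + 1) ^ 2 + 56 * ((e₁ : ℝ) + 1)
                  * ((e₂ : ℝ) + 1) ^ 3 + 12 * ((e₂ : ℝ) + 1) ^ 4) + 120 * (12 * ((e₁ : ℝ) + 1) ^ 2 + 26 * ((e₁ : ℝ) + 1) * ((e₂ : ℝ) + 1) + 12 * ((e₂ : ℝ) + 1) ^ 2) * rowPsi1 e₁ e₂ (a j₀ 0) (-(a j₀ 1)) (-(a j₀ 2)) x + 5040 * rowPsi1 e₁ e₂ (a j₀ 0) (-(a j₀ 1)) (-(a j₀ 2)) x ^ 2 < 0))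
    (hpoles : ∀ j, j ≠ j₀ → (a j 0 = 0 ∧ a j 1 * a j 2 < 0 ∧ 0 ≤ (∑ l, C (a j l) * X ^ (d l) : ℝ[X]).eval u * (∑ l, C (a j l) * X ^ (d l) : ℝ[X]).eval v) ∨ (a j 1 = 0 ∧ a j 0 * a j 2 < 0 ∧ 0 ≤ (∑ l, C (a j l) * X ^ (d l) : ℝ[X]).eval u * (∑ l, C (a j l) * X ^ (d l) : ℝ[X]).eval v)) :
    (((∏ j, ∑ l, C (a j l) * X ^ (d l) : ℝ[X]) * (X * derivative (X * derivative (∏ j, ∑ l, C (a j l) * X ^ (d l) : ℝ[X]))) - (X * derivative (∏ j, ∑ l, C (a j l) * X ^ (d l) : ℝ[X])) ^ 2).roots.toFinset.filter (fun t => u < t ∧ t < v)).card ≤ 8 := by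
  classical
  set Wp : ℝ[X] := ((∏ j, ∑ l, C (a j l) * X ^ (d l) : ℝ[X]) * (X * derivative (X * derivative (∏ j, ∑ l, C (a j l) * X ^ (d l) : ℝ[X]))) - (X * derivative (∏ j, ∑ l, C (a j l) * X ^ (d l) : ℝ[X])) ^ 2) with hWdef
  set T := Wp.roots.toFinset.filter (fun t => u < t ∧ t < v) with hT
  by_contra hgt
  push Not at hgt
  by_cases hW0 : Wp = 0
  · have : T = ∅ := by rw [hT, hW0, roots_zero, Multiset.toFinset_zero, Finset.filter_empty]
    rw [this, Finset.card_empty] at hgt; exact absurd hgt (by norm_num)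
  obtain ⟨T', hT'T, hcard⟩ := Finset.exists_subset_card_eq (show 9 ≤ T.card by omega)
  set x : Fin 9 → ℝ := fun i => T'.orderEmbOfFin hcard i with hxdef
  have hxmono : StrictMono x := fun i j hij => (T'.orderEmbOfFin hcard).strictMono hij
  have hxmem : ∀ i, x i ∈ T := fun i => hT'T (T'.orderEmbOfFin_mem hcard i)
  have hxI : ∀ i, x i ∈ Ioo u v := fun i => (Finset.mem_filter.1 (hxmem i)).2
  have hxz : ∀ i, Wp.eval (x i) = 0 := by
    intro i
    have h := (Finset.mem_filter.1 (hxmem i)).1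
    rw [Multiset.mem_toFinset, mem_roots hW0] at h
    exact h
  exact ringIsoPoles_no_nine_zeros d e₁ e₂ he₁ he₂ h2p a hu j₀ hknee hpoles x hxmono hxI hxz

end ProductPlusOne

end Summit.ValiantsHypothesis.ValiantsHypothesis.Theorems.LacunarySymmetroidMatrixDescartes
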